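/-
Copyright (c) 2026. Released under Apache 2.0 license as described in the file LICENSE.
-/
import Summits.RiemannHypothesis.RiemannHypothesis.Theorems.LiKernelTableCert
import Literature.NumberTheory.LFunctions.Xiao2020.Refutation
import Literature.NumberTheory.LFunctions.KeiperLiAsymptoticCriteria
import Literature.NumberTheory.LFunctions.BombieriLagariasEtaIdentification
import HarnessLib

/-!
# KERNEL LINEAGE K of the Keiper–Li table: soundness and the exported rows (`1 ≤ n ≤ 119`)

RH-FREE DATA.  bears_on: LADDER-RH L-D (a) (COLUMN 4 LI, DATA rung).  WHAT THIS IS NOT: a table of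
`λₙ` — however certified — is not evidence for RH; `λₙ > 0` for `n ≤ 119` says nothing about Li's
criterion `∀ n, λₙ ≥ 0`; nothing here bears on the truth of RH.

`LiKernelTableCert.lean` evaluates the integer-interval certificate `certK` in the kernel.  Here we prove
what it certifies, in the tree's vocabulary:

* `keiperLiCoeff_mem_row` — `λₙ ∈ [lamLo n, lamHi n]·10^{−rowDigits n}` (`λₙ = keiperLiCoeff n`);
* `liOscPart_mem_row` — the ARITHMETIC (oscillating) part `λ̃ₙ = liOscPart n` (Coffey's `S₂(n)`,
  Maślanka's `λ̃ₙ`, Bombieri–Lagarias' `−Σ C(n,j) η_{j−1}`; `= Σ_{j<n} C(n,j+1) Re qⱼ`,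
  `liOscPart_eq_sum_zetaOneLogDerivCoeff`) `∈ [oscLo n, oscHi n]·10^{−rowDigits n}`;
* `liTrend_mem_row` — the ARCHIMEDEAN part `λ̄ₙ = liTrend n = λₙ − λ̃ₙ` (`Coffey2005_thm1_holds`);
* `keiperLiCoeff_pos_of_le`, `keiperLiCoeff_strictMonoOn` — `0 < λ₁ < λ₂ < ⋯ < λ₁₁₉` unconditionally;
* (in `LiKernelTableCorollaries.lean`: `γ` to 49 decimals, sample rows in decimals, `0 < λ̃ₙ ≤ 2.04`).

Certified half-widths: `10⁻⁵⁰` at `n = 1`, `10⁻⁴⁵` at `n = 10`, `10⁻¹⁹` at `n = 100`, `10⁻¹³` at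
`n = 119`.  The three lineages of record of the cell (A: Arb; D: GMP fixed point; K: this file) agree:
every lineage-D midpoint of `λₙ`, `lbₙ = λ̄ₙ`, `ltₙ = λ̃ₙ`, `n ≤ 119`, lies in the kernel row (checked
outside Lean; DATA.md §H/§K of the rh-li cell).

Soundness chain: `uList_spec`, `qList_spec`, `aList_spec` (`Xiao2020.Refutation`); `a₁ = λ₁ =
1 + γ/2 − log 2 − ½ log π` (`keiperLiCoeff_one_eq`) with `γ = u₁` (`zetaOneTaylorCoeff_one`), `π`, `log 2`,
`log(π/4)` by `MI.mem_pi`, `MI.mem_logTwo`, `MI.mem_logOneSub`; `λₙ = Σ k C(n,k) aₖ`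
(`keiperLiCoeff_eq_sum_aR`); the rows are read off with `mem_dotZ` and Pascal rows (`rowIs_pascalNext`).
-/

set_option linter.dupNamespace false

namespace Summit.RiemannHypothesis.RiemannHypothesis.Theorems.LiKernel

open Literature.NumberTheory.LFunctions Literature.NumberTheory.LFunctions.Xiao2020
open Literature.NumberTheory.LFunctions.Xiao2020.CertKernel
open Literature.Analysis.ValidatedNumerics Literature.Analysis.ValidatedNumerics.NumericsMP
open Finset
open scoped Nat

variable {S : ℕ}

/-! ## The weight rows -/

/-- `lrow` reads the weights `k·C(n,k)` off the binomial row of `n`. -/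
lemma lrow_spec {n len : ℕ} {R : List ℕ} (h : RowIs n.choose len R) :
    (lrow len R).length = len ∧ ∀ k < len, (lrow len R).getD k 0 = ((k * n.choose k : ℕ) : ℤ) := by
  refine ⟨by simp [lrow, h.1], fun k hk ↦ ?_⟩
  rw [lrow, getD_zipWith_lt _ (by simpa using hk) (by rw [h.1]; exact hk) 0 0 0, h.2 k hk,
    List.getD_eq_getElem?_getD, List.getElem?_range hk]
  simp

/-- `crow` reads the weights `C(n,j+1)` off the binomial row of `n`. -/
lemma crow_spec {n len : ℕ} {R : List ℕ} (h : RowIs n.choose (len + 1) R) :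
    (crow R).length = len ∧ ∀ j < len, (crow R).getD j 0 = ((n.choose (j + 1) : ℕ) : ℤ) := by
  obtain ⟨hl, hg⟩ := h
  cases R with
  | nil => simp at hl
  | cons a R =>
    refine ⟨by simpa [crow] using hl, fun j hj ↦ ?_⟩
    have e := hg (j + 1) (by omega)
    rw [List.getD_cons_succ] at e
    have hm : (List.map (fun c : ℕ ↦ (c : ℤ)) R).getD j ((fun c : ℕ ↦ (c : ℤ)) 0) =
        ((R.getD j 0 : ℕ) : ℤ) := List.getD_map (l := R) (d := 0) (f := fun c : ℕ ↦ (c : ℤ))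
    simp only [Nat.cast_zero] at hm
    rw [crow, List.tail_cons, hm, e]

/-- The row of `n = 1`. -/
lemma rowIs_row1 : RowIs (Nat.choose 1) (IMAX + 1) row1 := by
  simpa [row1] using rowIs_pascalNext (rowIs_row0 IMAX)

/-! ## What the two row programs enclose -/

/-- Length of `lamSeq`. -/
@[simp] lemma length_lamSeq (A1 : MI) (A : List MI) (len : ℕ) :
    ∀ (R : List ℕ) (n c : ℕ), (lamSeq A1 A len R n c).length = c
  | _, _, 0 => rfl
  | R, n, c + 1 => by simp [lamSeq, length_lamSeq]

/-- Length of `oscSeq`. -/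
@[simp] lemma length_oscSeq (Q : List MI) : ∀ (R : List ℕ) (c : ℕ), (oscSeq Q R c).length = c
  | _, 0 => rfl
  | R, c + 1 => by simp [oscSeq, length_oscSeq]

/-- `lamSeq` encloses `j ↦ (n+j) a₁ + Σₖ k C(n+j,k) a'ₖ`. -/
lemma encl_lamSeq {a1 : ℝ} {A1 : MI} (h1 : MI.mem S a1 A1) {a : ℕ → ℝ} {A : List MI}
    (hA : Encl S a A) {len : ℕ} (hAl : A.length = len) :
    ∀ (c n : ℕ) (R : List ℕ), RowIs n.choose len R →
      Encl S (fun j ↦ ((n + j : ℕ) : ℝ) * a1 +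
        ∑ k ∈ Finset.range len, ((k * (n + j).choose k : ℕ) : ℝ) * a k) (lamSeq A1 A len R n c)
  | 0, _, _, _ => trivial
  | c + 1, n, R, hR => by
    simp only [lamSeq]
    refine ⟨?_, ?_⟩
    · obtain ⟨hl, he⟩ := lrow_spec hR
      have hdot := mem_dotZ (lrow len R) hA
      rw [hl, hAl, min_self] at hdot
      have hsum : ∑ k ∈ Finset.range len, ((lrow len R).getD k 0 : ℝ) * a k =
          ∑ k ∈ Finset.range len, ((k * n.choose k : ℕ) : ℝ) * a k :=
        Finset.sum_congr rfl fun k hk ↦ by rw [he k (Finset.mem_range.1 hk)]; push_cast; ring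
      rw [hsum] at hdot
      have := MI.mem_add (MI.mem_mulInt h1 (n : ℤ)) hdot
      simp only [Nat.add_zero]
      convert this using 2
      push_cast
      ring
    · have := encl_lamSeq h1 hA hAl c (n + 1) (pascalNext R) (rowIs_pascalNext hR)
      exact this.congr' fun j ↦ by simp [add_assoc, add_comm 1 j]

/-- `oscSeq` encloses `j ↦ Σᵢ C(n+j, i+1) qᵢ`. -/
lemma encl_oscSeq {q : ℕ → ℝ} {Q : List MI} (hQ : Encl S q Q) {len : ℕ} (hQl : Q.length = len) :
    ∀ (c n : ℕ) (R : List ℕ), RowIs n.choose (len + 1) R →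
      Encl S (fun j ↦ ∑ i ∈ Finset.range len, (((n + j).choose (i + 1) : ℕ) : ℝ) * q i)
        (oscSeq Q R c)
  | 0, _, _, _ => trivial
  | c + 1, n, R, hR => by
    simp only [oscSeq]
    refine ⟨?_, ?_⟩
    · obtain ⟨hl, he⟩ := crow_spec hR
      have hdot := mem_dotZ (crow R) hQ
      rw [hl, hQl, min_self] at hdot
      have hsum : ∑ i ∈ Finset.range len, ((crow R).getD i 0 : ℝ) * q i =
          ∑ i ∈ Finset.range len, ((n.choose (i + 1) : ℕ) : ℝ) * q i :=
        Finset.sum_congr rfl fun i hi ↦ by rw [he i (Finset.mem_range.1 hi)]; push_cast; ring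
      rw [hsum] at hdot
      simpa using hdot
    · have := encl_oscSeq hQ hQl c (n + 1) (pascalNext R) (rowIs_pascalNext hR)
      exact this.congr' fun j ↦ by simp [add_assoc, add_comm 1 j]

/-! ## The real numbers behind the boxes -/

/-- `u₁ = γ`. -/
lemma uR_one : uR 1 = Real.eulerMascheroniConstant := by
  rw [uR, zetaOneTaylorCoeff_one, Complex.ofReal_re]

/-- `a₁ = λ₁`. -/
lemma aR_one : aR 1 = keiperLiCoeff 1 := by
  rw [keiperLiCoeff_eq_sum_aR le_rfl (by simp [IMAX]), Finset.sum_eq_single 1]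
  · simp
  · intro k _ hk
    rcases Nat.lt_or_gt_of_ne hk with h | h
    · interval_cases k; simp
    · rw [Nat.choose_eq_zero_of_lt h]; simp
  · simp [IMAX]

/-- `a₁ = 1 + γ/2 − log 2 − ½ log π`. -/
lemma aR_one_eq :
    aR 1 = -(Real.log Real.pi / 2) + Real.eulerMascheroniConstant / 2 + 1 - Real.log 2 := by
  rw [aR_one, keiperLiCoeff_one_eq]

/-- `λₘ = m a₁ + Σₖ k C(m,k) a'ₖ` (`a'₀ = a'₁ = 0`), `1 ≤ m ≤ 119`. -/
lemma lam_eq {m : ℕ} (hm : 1 ≤ m) (hm' : m ≤ IMAX) :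
    (m : ℝ) * aR 1 + ∑ k ∈ Finset.range (IMAX + 1), ((k * m.choose k : ℕ) : ℝ) * aR' k =
      keiperLiCoeff m := by
  rw [keiperLiCoeff_eq_sum_aR hm hm']
  have hsplit : ∀ k ∈ Finset.range (IMAX + 1), ((k : ℝ) * (m.choose k : ℝ)) * aR k =
      ((k * m.choose k : ℕ) : ℝ) * aR' k + (if k = 1 then (m : ℝ) * aR 1 else 0) := by
    intro k _
    by_cases hk : k < 2
    · interval_cases k <;> simp [aR']
    · rw [aR', if_neg hk, if_neg (by omega)]; push_cast; ring
  rw [Finset.sum_congr rfl hsplit, Finset.sum_add_distrib, Finset.sum_ite_eq', if_pos (by simp [IMAX])]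
  ring

/-- `Σ_{i<119} C(m,i+1) qᵢ = λ̃ₘ = liOscPart m` for `m ≤ 119` (the terms `i ≥ m` vanish). -/
lemma osc_eq {m : ℕ} (hm' : m ≤ IMAX) :
    ∑ i ∈ Finset.range IMAX, ((m.choose (i + 1) : ℕ) : ℝ) * qR i = liOscPart m := by
  rw [liOscPart_eq_sum_zetaOneLogDerivCoeff]
  simp only [qR]
  symm
  refine Finset.sum_subset (Finset.range_subset_range.2 hm') fun i _ hi ↦ ?_
  rw [Finset.mem_range, not_lt] at hi
  rw [Nat.choose_eq_zero_of_lt (by omega)]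
  simp

/-- `λ̄ₘ = liTrend m = λₘ − λ̃ₘ` (`m ≥ 1`). -/
lemma trend_eq {m : ℕ} (hm : 1 ≤ m) : liTrend m = keiperLiCoeff m - liOscPart m := by
  have := (Coffey2005_thm1_holds).2 m hm
  linarith

/-- What `a1Box` encloses: `a₁`. -/
lemma mem_a1Box (hS : 0 < SC) {U : List MI} (hU : Encl SC uR U) (hUl : U.length = IMAX + 1)
    {A1 : MI} (h : a1Box U = some A1) : MI.mem SC (aR 1) A1 := by
  unfold a1Box at h
  split at h
  · rename_i P L2 hP hL2
    split at h
    · rename_i Y hY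
      simp only [Option.some.injEq] at h
      subst h
      have hπ : MI.mem SC Real.pi P := MI.mem_pi SC hP
      have hl2 : MI.mem SC (Real.log 2) L2 := MI.mem_logTwo hS hL2
      have hX : MI.mem SC (1 - Real.pi / 4) ((MI.ofInt SC 1).sub (P.divNat 4)) := by
        have := MI.mem_sub (MI.mem_ofInt SC 1) (MI.mem_divNat hπ (n := 4) (by norm_num))
        simpa using this
      have hlog : MI.mem SC (Real.log (1 - (1 - Real.pi / 4))) Y := MI.mem_logOneSub hS hY hX
      have hγ : MI.mem SC Real.eulerMascheroniConstant (U.getD 1 zeroI) := by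
        have := hU.getD (i := 1) (by rw [hUl]; simp [IMAX])
        rwa [uR_one] at this
      have hfin := MI.mem_sub (MI.mem_sub (MI.mem_add (MI.mem_ofInt SC 1)
        (MI.mem_divNat hγ (n := 2) (by norm_num))) (MI.mem_mulInt hl2 2))
        (MI.mem_divNat hlog (n := 2) (by norm_num))
      convert hfin using 2
      rw [aR_one_eq, sub_sub_cancel, Real.log_div Real.pi_ne_zero (by norm_num),
        show (4 : ℝ) = 2 ^ 2 by norm_num, Real.log_pow]
      push_cast
      ring
    · simp at h
  · simp at h

/-! ## Reading the table checks -/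

/-- From the cross-multiplied integer test to the real enclosure. -/
lemma bounds_of_test (hS : 0 < S) {x : ℝ} {I : MI} (hx : MI.mem S x I) {d : ℕ} {l h : ℤ}
    (hl : l * (S : ℤ) ≤ I.lo * ((10 ^ d : ℕ) : ℤ)) (hh : I.hi * ((10 ^ d : ℕ) : ℤ) ≤ h * (S : ℤ)) :
    (l : ℝ) / 10 ^ d ≤ x ∧ x ≤ (h : ℝ) / 10 ^ d := by
  have hSr : (0 : ℝ) < S := by exact_mod_cast hS
  have hD : (0 : ℝ) < (10 : ℝ) ^ d := by positivity
  obtain ⟨h1, h2⟩ := hx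
  have hl' : (l : ℝ) * S ≤ (I.lo : ℝ) * (10 : ℝ) ^ d := by exact_mod_cast hl
  have hh' : (I.hi : ℝ) * (10 : ℝ) ^ d ≤ (h : ℝ) * S := by exact_mod_cast hh
  constructor
  · rw [div_le_iff₀ hD]
    have : (l : ℝ) * S ≤ x * 10 ^ d * S := by nlinarith
    exact le_of_mul_le_mul_right this hSr
  · rw [le_div_iff₀ hD]
    have : x * 10 ^ d * S ≤ (h : ℝ) * S := by nlinarith
    exact le_of_mul_le_mul_right this hSr

/-- What `checkRows … = true` says, entry by entry. -/
lemma checkRows_spec (S : ℕ) : ∀ (T : List (ℕ × ℤ × ℤ × ℤ × ℤ)) (Ls Os : List MI) (p : ℤ),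
    checkRows S Ls Os T p = true →
      Ls.length = T.length ∧ Os.length = T.length ∧
      (∀ i < T.length, rowOK S (Ls.getD i zeroI) (Os.getD i zeroI) (T.getD i (0, 0, 0, 0, 0)) = true ∧
        0 < (Ls.getD i zeroI).lo) ∧
      (0 < T.length → p < (Ls.getD 0 zeroI).lo) ∧
      (∀ i, i + 1 < T.length → (Ls.getD i zeroI).hi < (Ls.getD (i + 1) zeroI).lo)
  | [], Ls, Os, p, h => by
    cases Ls with
    | nil =>
      cases Os with
      | nil => simp
      | cons O Os => simp [checkRows] at h
    | cons L Ls => simp [checkRows] at h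
  | r :: rs, Ls, Os, p, h => by
    cases Ls with
    | nil => simp [checkRows] at h
    | cons L Ls =>
      cases Os with
      | nil => simp [checkRows] at h
      | cons O Os =>
        simp only [checkRows, Bool.and_eq_true, decide_eq_true_eq] at h
        obtain ⟨⟨⟨hr, hpos⟩, hp⟩, hrest⟩ := h
        obtain ⟨hl1, hl2, hrows, hhead, hmono⟩ := checkRows_spec S rs Ls Os L.hi hrest
        refine ⟨by simp [hl1], by simp [hl2], fun i hi ↦ ?_, fun _ ↦ by simpa using hp, fun i hi ↦ ?_⟩
        · cases i with
          | zero => simpa using ⟨hr, hpos⟩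
          | succ i => simpa using hrows i (by simpa using hi)
        · cases i with
          | zero => simpa using hhead (by simpa using hi)
          | succ i => simpa using hmono i (by simpa using hi)

/-- The table has `119` rows. -/
lemma length_kTable : kTable.length = 119 := by decide

/-! ## Soundness of the certificate -/

/-- **Soundness.** If the kernel evaluates `certK` to `true`, then `γ` lies in `gammaRow`, and for
every `1 ≤ n ≤ 119`: `λₙ` and `λ̃ₙ = liOscPart n` lie in row `n` of `kTable`, `λₙ > 0`, and
`λₙ₋₁ < λₙ` (`n ≥ 2`). -/
theorem certK_sound (h : certK = true) :
    ((gammaRow.2.1 : ℝ) / 10 ^ gammaRow.1 ≤ Real.eulerMascheroniConstant ∧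
      Real.eulerMascheroniConstant ≤ (gammaRow.2.2 : ℝ) / 10 ^ gammaRow.1) ∧
    ∀ n, 1 ≤ n → n ≤ 119 →
      ((lamLo n : ℝ) / 10 ^ rowDigits n ≤ keiperLiCoeff n ∧
        keiperLiCoeff n ≤ (lamHi n : ℝ) / 10 ^ rowDigits n) ∧
      ((oscLo n : ℝ) / 10 ^ rowDigits n ≤ liOscPart n ∧
        liOscPart n ≤ (oscHi n : ℝ) / 10 ^ rowDigits n) ∧
      0 < keiperLiCoeff n ∧ (2 ≤ n → keiperLiCoeff (n - 1) < keiperLiCoeff n) := by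
  unfold certK at h
  split at h
  · exact absurd h (by simp)
  · rename_i U hU
    split at h
    · exact absurd h (by simp)
    · rename_i A1 hA1
      have hS : 0 < SC := by simp [SC]
      obtain ⟨hUl, hUe⟩ := uList_spec hU
      obtain ⟨hQl, hQe⟩ := qList_spec hUe hUl
      obtain ⟨hAl, hAe⟩ := aList_spec hQe hQl
      have ha1 := mem_a1Box hS hUe hUl hA1
      unfold certRows at h
      simp only [Bool.and_eq_true] at h
      obtain ⟨hg, hrows⟩ := h
      -- the rows
      set Ls := lamSeq A1 (aList (qList U)) (IMAX + 1) row1 1 IMAX with hLs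
      set Os := oscSeq (qList U) row1 IMAX with hOs
      have hL := encl_lamSeq ha1 hAe hAl IMAX 1 row1 rowIs_row1
      have hO := encl_oscSeq hQe hQl IMAX 1 row1 rowIs_row1
      obtain ⟨-, -, hrow, -, hmono⟩ := checkRows_spec SC kTable Ls Os (-1) hrows
      have hmemL : ∀ m, 1 ≤ m → m ≤ 119 → MI.mem SC (keiperLiCoeff m) (Ls.getD (m - 1) zeroI) := by
        intro m hm hm'
        have := hL.getD (i := m - 1) (by rw [length_lamSeq]; simp only [IMAX]; omega)
        rw [show 1 + (m - 1) = m by omega, lam_eq hm (by simp only [IMAX]; omega)] at this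
        exact this
      have hmemO : ∀ m, 1 ≤ m → m ≤ 119 → MI.mem SC (liOscPart m) (Os.getD (m - 1) zeroI) := by
        intro m hm hm'
        have := hO.getD (i := m - 1) (by rw [length_oscSeq]; simp only [IMAX]; omega)
        rw [show 1 + (m - 1) = m by omega, osc_eq (by simp only [IMAX]; omega)] at this
        exact this
      refine ⟨?_, fun n hn hn' ↦ ?_⟩
      · -- gamma
        have hγ : MI.mem SC Real.eulerMascheroniConstant (U.getD 1 zeroI) := by
          have := hUe.getD (i := 1) (by rw [hUl]; simp [IMAX])
          rwa [uR_one] at this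
        simp only [gammaOK, Bool.and_eq_true, decide_eq_true_eq] at hg
        exact bounds_of_test hS hγ hg.1 hg.2
      · obtain ⟨hr, hpos⟩ := hrow (n - 1) (by rw [length_kTable]; omega)
        simp only [rowOK, Bool.and_eq_true, decide_eq_true_eq] at hr
        obtain ⟨⟨⟨h1, h2⟩, h3⟩, h4⟩ := hr
        have hmL := hmemL n hn hn'
        have hmO := hmemO n hn hn'
        refine ⟨bounds_of_test hS hmL h1 h2, bounds_of_test hS hmO h3 h4, MI.pos_of_lo_pos hmL hpos,
          fun h2n ↦ ?_⟩
        have hlt := hmono (n - 2) (by rw [length_kTable]; omega)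
        rw [show n - 2 + 1 = n - 1 by omega] at hlt
        have hmL' := hmemL (n - 1) (by omega) (by omega)
        rw [show n - 1 - 1 = n - 2 by omega] at hmL'
        exact MI.lt_of_hi_lt_lo hmL' hmL hlt

/-! ## The exported rows -/

/-- **Row `n` for `λₙ`** (`1 ≤ n ≤ 119`): `λₙ ∈ [lamLo n, lamHi n]·10^{−rowDigits n}`. RH-FREE DATA. -/
theorem keiperLiCoeff_mem_row {n : ℕ} (hn : 1 ≤ n) (hn' : n ≤ 119) :
    (lamLo n : ℝ) / 10 ^ rowDigits n ≤ keiperLiCoeff n ∧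
      keiperLiCoeff n ≤ (lamHi n : ℝ) / 10 ^ rowDigits n :=
  ((certK_sound certK_true).2 n hn hn').1

/-- **Row `n` for the arithmetic part `λ̃ₙ = liOscPart n`** (`1 ≤ n ≤ 119`):
`λ̃ₙ ∈ [oscLo n, oscHi n]·10^{−rowDigits n}`. RH-FREE DATA. -/
theorem liOscPart_mem_row {n : ℕ} (hn : 1 ≤ n) (hn' : n ≤ 119) :
    (oscLo n : ℝ) / 10 ^ rowDigits n ≤ liOscPart n ∧
      liOscPart n ≤ (oscHi n : ℝ) / 10 ^ rowDigits n :=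
  ((certK_sound certK_true).2 n hn hn').2.1

/-- **Row `n` for the archimedean part `λ̄ₙ = liTrend n = λₙ − λ̃ₙ`** (`1 ≤ n ≤ 119`):
`λ̄ₙ ∈ [lamLo n − oscHi n, lamHi n − oscLo n]·10^{−rowDigits n}`. RH-FREE DATA. -/
theorem liTrend_mem_row {n : ℕ} (hn : 1 ≤ n) (hn' : n ≤ 119) :
    ((lamLo n : ℝ) - oscHi n) / 10 ^ rowDigits n ≤ liTrend n ∧
      liTrend n ≤ ((lamHi n : ℝ) - oscLo n) / 10 ^ rowDigits n := by
  obtain ⟨h1, h2⟩ := keiperLiCoeff_mem_row hn hn'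
  obtain ⟨h3, h4⟩ := liOscPart_mem_row hn hn'
  rw [trend_eq hn, sub_div, sub_div]
  exact ⟨by linarith, by linarith⟩

/-- **`λₙ > 0` for `1 ≤ n ≤ 119`**, unconditionally (kernel-certified numbers; not a statement about
RH, whose Li criterion is `∀ n`). -/
theorem keiperLiCoeff_pos_of_le {n : ℕ} (hn : 1 ≤ n) (hn' : n ≤ 119) : 0 < keiperLiCoeff n :=
  ((certK_sound certK_true).2 n hn hn').2.2.1

/-- **`λ₁ < λ₂ < ⋯ < λ₁₁₉`**: the Keiper–Li coefficients are strictly increasing on `1 ≤ n ≤ 119`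
(kernel-certified; consecutive boxes are disjoint). RH-FREE DATA. -/
theorem keiperLiCoeff_strictMonoOn : StrictMonoOn keiperLiCoeff (Set.Icc 1 119) := by
  have step : ∀ n, 1 ≤ n → n + 1 ≤ 119 → keiperLiCoeff n < keiperLiCoeff (n + 1) := fun n h1 h2 ↦ by
    have := ((certK_sound certK_true).2 (n + 1) (by omega) h2).2.2.2 (by omega)
    simpa using this
  intro a ha b hb hab
  obtain ⟨k, rfl⟩ : ∃ k, b = a + (k + 1) := ⟨b - a - 1, by omega⟩
  induction k with
  | zero => exact step a ha.1 (by have := hb.2; omega)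
  | succ k ih =>
    have hb' : a + (k + 1) ∈ Set.Icc 1 119 := ⟨by omega, by have := hb.2; omega⟩
    have h2 := step (a + (k + 1)) (by omega) (by have := hb.2; omega)
    rw [show a + (k + 1) + 1 = a + (k + 1 + 1) by omega] at h2
    exact (ih hb' (by omega)).trans h2

end Summit.RiemannHypothesis.RiemannHypothesis.Theorems.LiKernel
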